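import Summits.ResolutionOfSingularities.ResolutionOfSingularities.Theorems.FrobeniusLadderFInjectiveMacaulayficationPencilStalkPackage
import HarnessLib

/-!
# BED Ω₁ GLOBAL PATCH, F6 v2 GLUE AT THE STALK — the «over the point» form: FULL stalks of a blowing up along a 2-generated centre from a regular pair of GERMS and FULL of the
# pencil rings `B[X]/(aX − b)`, `B[X]/(bX − a)` (`B = 𝒪_{Y,π′y′}`) at the primes lying OVER THE MAXIMAL IDEAL of `B` only
# (`g15/F6-ARCHITECTURE-v2.md` §4 F3; crux `FInjectiveMacaulayfication` stmt-ResolutionOfSingularities-15315, chain w45a; seat res-L1-w45a-stub-3 g15)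

[OURS · L1 W4.5a] Support file (`--supports stmt-ResolutionOfSingularities-15315 --as helper`); theorems only; GENERIC; no named fact; NOT a statement of any manuscript; nothing of the
crux is proved. AI-written (AI review is weaker than expert review).

Refines ✓ `PencilStalkPackage.fullCl_stalk_of_pair_stalk` / `…_transport` / `…_germ`: there the FULL hypothesis was demanded at EVERY prime of `B[X]/(aX − b)`; the point `y′` only sees
the primes `Q` with `Q ∩ B = 𝔪_B` (✓ Literature `IsBlowup.exists_blowupAlgebra_stalk_ringEquiv_of_eq`, fourth output), which is exactly where ✓ `PencilFedderRegularBase` certifies FULL.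
* `fullCl_localization_of_ringEquiv_at` — pointwise transport of FULL of localizations along a ring isomorphism;
* ★★ `fullCl_stalk_of_pair_stalk_over`, `fullCl_stalk_of_pair_transport_over`, ★★ `fullCl_stalk_of_pair_germ_over` — the three forms of ✓ `PencilStalkPackage` with «over `𝔪`» hypotheses.
[cite: StacksProject, Tag 0804, Tag 0BIQ; GortzWedhorn2020, (13.19)]
-/

set_option linter.dupNamespace false

noncomputable section

open AlgebraicGeometry CategoryTheory Polynomial IsLocalRing Literature.AlgebraicGeometry.Resolution

namespace Summit.ResolutionOfSingularities.ResolutionOfSingularities.Theorems.FInjectiveMacaulayfication.PencilStalkOverPoint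

open Summit.ResolutionOfSingularities.ResolutionOfSingularities.Theorems.FInjectiveMacaulayfication
open SliceableCentre PencilBlowupLocalCharts PencilBlowupLocalChartsFull PencilStalkPackage

/-! ## Pointwise transport -/

/-- FULL of the localization at ONE prime, transported along a ring isomorphism `e : A ≃+* B` (the prime of `A` is `Q ∩ A := e⁻¹Q`). [folklore transport] -/
theorem fullCl_localization_of_ringEquiv_at (p : ℕ) {A B : Type} [CommRing A] [CommRing B] (e : A ≃+* B) (Q : Ideal B) [Q.IsPrime]
    (h : FullCl p (Localization.AtPrime (Q.comap e.toRingHom))) : FullCl p (Localization.AtPrime Q) := by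
  have eP : Localization.AtPrime (Q.comap e.toRingHom) ≃+* Localization.AtPrime Q := by
    refine IsLocalization.ringEquivOfRingEquiv (M := (Q.comap e.toRingHom).primeCompl) (T := Q.primeCompl)
      (Localization.AtPrime (Q.comap e.toRingHom)) (Localization.AtPrime Q) e ?_
    ext y
    simp only [Submonoid.mem_map]
    constructor
    · rintro ⟨b, hb, rfl⟩
      intro hy
      exact hb (by simpa [Ideal.mem_comap] using hy)
    · intro hy
      refine ⟨e.symm y, fun h' => hy ?_, e.apply_symm_apply y⟩
      simpa [Ideal.mem_comap] using h'
  exact fullCl_of_ringEquiv' p eP h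

/-- «Over `𝔪`» is preserved when the prime is pulled back along an isomorphism of pencil rings compatible with the coefficient maps of an isomorphism `Φ` of local rings. [plumbing] -/
theorem over_of_comap {B₀ B : Type} [CommRing B₀] [CommRing B] [IsLocalRing B₀] [IsLocalRing B] (Φ : B₀ ≃+* B) (f₀ : B₀[X]) (f : B[X])
    (ψ : (B₀[X] ⧸ Ideal.span {f₀}) ≃+* (B[X] ⧸ Ideal.span {f})) (hψ : ∀ a, ψ (Ideal.Quotient.mk _ (C a)) = Ideal.Quotient.mk _ (C (Φ a)))
    (Q : Ideal (B[X] ⧸ Ideal.span {f})) (hQ : (Q.comap (Ideal.Quotient.mk (Ideal.span {f}))).comap C = maximalIdeal B) :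
    ((Q.comap ψ.toRingHom).comap (Ideal.Quotient.mk (Ideal.span {f₀}))).comap C = maximalIdeal B₀ := by
  ext a
  simp only [Ideal.mem_comap, RingEquiv.toRingHom_eq_coe, RingHom.coe_coe, hψ]
  have h1 : Φ a ∈ maximalIdeal B ↔ a ∈ maximalIdeal B₀ := by
    rw [mem_maximalIdeal, mem_maximalIdeal, mem_nonunits_iff, mem_nonunits_iff, not_iff_not]
    exact MulEquiv.isUnit_map Φ.toMulEquiv
  rw [← h1, ← hQ, Ideal.mem_comap, Ideal.mem_comap]

/-! ## The stalk package over the point -/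

variable {Y Y' : Scheme.{0}} {π' : Y' ⟶ Y} {J : Y.IdealSheafData}

/-- Bookkeeping: FULL at a prime over `𝔪` of `B[(a,b)/a]` for the ideal `(b, a) = (a, b)` (propositional rewrite of the blow-up algebra's ideal). [plumbing] -/
theorem fullCl_loc_blowupAlgebra_congr_over (p : ℕ) {B : Type} [CommRing B] [IsLocalRing B] {I I' : Ideal B} (h : I = I') (t : B)
    (H : ∀ (Q : Ideal (blowupAlgebra I' t)) [Q.IsPrime], Q.comap (algebraMap B (blowupAlgebra I' t)) = maximalIdeal B → FullCl p (Localization.AtPrime Q))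
    (Q : Ideal (blowupAlgebra I t)) [Q.IsPrime] (hQ : Q.comap (algebraMap B (blowupAlgebra I t)) = maximalIdeal B) :
    FullCl p (Localization.AtPrime Q) := by
  subst h; exact H Q hQ

/-- FULL of the blow-up algebra `B[(a,b)/a]` at primes over `𝔪` from FULL of `B[X]/(aX − b)` at primes over `𝔪` (regular pair `(a, b)`; Stacks 0BIQ ✓ `ringEquiv_quotient_blowupAlgebra_pair`).
[OURS · F6 glue; cite: StacksProject, Tag 0BIQ] -/
theorem fullCl_loc_blowupAlgebra_over (p : ℕ) {B : Type} [CommRing B] [IsLocalRing B] (a b : B)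
    (ha : a ∈ nonZeroDivisors B) (hab : ∀ r : B, a ∣ r * b → a ∣ r)
    (hA : ∀ (Q : Ideal (B[X] ⧸ Ideal.span {C a * X - C b})) [Q.IsPrime],
      (Q.comap (Ideal.Quotient.mk (Ideal.span {C a * X - C b}))).comap C = maximalIdeal B → FullCl p (Localization.AtPrime Q))
    (Q : Ideal (blowupAlgebra (Ideal.span {a, b}) a)) [Q.IsPrime] (hQ : Q.comap (algebraMap B (blowupAlgebra (Ideal.span {a, b}) a)) = maximalIdeal B) :
    FullCl p (Localization.AtPrime Q) := by
  obtain ⟨θ, hθa, -⟩ := ringEquiv_quotient_blowupAlgebra_pair a b ha hab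
  haveI : (Q.comap θ.toRingHom).IsPrime := Ideal.comap_isPrime _ Q
  refine fullCl_localization_of_ringEquiv_at p θ Q (hA _ ?_)
  rw [← hQ]
  ext x
  simp only [Ideal.mem_comap, RingEquiv.toRingHom_eq_coe, RingHom.coe_coe, hθa]

/-- ★★ **FULL AT A POINT OF A BLOWING UP FROM A REGULAR PAIR OF GERMS, WITH THE PENCIL RINGS FULL AT THE PRIMES OVER THE POINT.** As ✓ `PencilStalkPackage.fullCl_stalk_of_pair_stalk`, but `hA`,
`hB` are required only at the primes `Q` of `B[X]/(aX − b)`, `B[X]/(bX − a)` with `Q ∩ B = 𝔪_B` (`B = 𝒪_{Y,π′y′}`). [OURS · F6 v2 glue at the stalk; cite: StacksProject, Tag 0804, Tag 0BIQ] -/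
theorem fullCl_stalk_of_pair_stalk_over (p : ℕ) (hπ : IsBlowup π' J) (y' : Y') (a b : Y.presheaf.stalk (π'.base y'))
    (hJ : stalkIdeal J (π'.base y') = Ideal.span {a, b})
    (ha : a ∈ nonZeroDivisors (Y.presheaf.stalk (π'.base y'))) (hab : ∀ r : Y.presheaf.stalk (π'.base y'), a ∣ r * b → a ∣ r)
    (hb : b ∈ nonZeroDivisors (Y.presheaf.stalk (π'.base y'))) (hba : ∀ r : Y.presheaf.stalk (π'.base y'), b ∣ r * a → b ∣ r)
    (hA : ∀ (Q : Ideal (Polynomial (Y.presheaf.stalk (π'.base y')) ⧸ Ideal.span {C a * X - C b})) [Q.IsPrime],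
      (Q.comap (Ideal.Quotient.mk _)).comap C = maximalIdeal (Y.presheaf.stalk (π'.base y')) → FullCl p (Localization.AtPrime Q))
    (hB : ∀ (Q : Ideal (Polynomial (Y.presheaf.stalk (π'.base y')) ⧸ Ideal.span {C b * X - C a})) [Q.IsPrime],
      (Q.comap (Ideal.Quotient.mk _)).comap C = maximalIdeal (Y.presheaf.stalk (π'.base y')) → FullCl p (Localization.AtPrime Q)) :
    FullCl p (Y'.presheaf.stalk y') := by
  have hI : Ideal.span {a, b} = Ideal.span (Set.range ![a, b]) := by
    congr 1
    ext x
    simp only [Set.mem_insert_iff, Set.mem_singleton_iff, Set.mem_range]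
    constructor
    · rintro (rfl | rfl)
      · exact ⟨0, rfl⟩
      · exact ⟨1, rfl⟩
    · rintro ⟨i, rfl⟩
      rcases i with ⟨_ | _ | i, hi⟩
      · exact Or.inl rfl
      · exact Or.inr rfl
      · omega
  obtain ⟨j, 𝔔, χ, e, -, -, -, h𝔔⟩ := hπ.exists_blowupAlgebra_stalk_ringEquiv_of_eq y' ![a, b] (Ideal.span {a, b}) hI hJ.symm
  have hj : j = 0 ∨ j = 1 := by
    rcases j with ⟨_ | _ | j, hj⟩
    · exact Or.inl rfl
    · exact Or.inr rfl
    · omega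
  have key : FullCl p (Localization.AtPrime 𝔔.asIdeal) := by
    rcases hj with rfl | rfl
    · have h𝔔p : (𝔔.asIdeal : Ideal (blowupAlgebra (Ideal.span {a, b}) a)).IsPrime := 𝔔.isPrime
      exact @fullCl_loc_blowupAlgebra_over p _ _ _ a b ha hab hA (𝔔.asIdeal : Ideal (blowupAlgebra (Ideal.span {a, b}) a)) h𝔔p h𝔔
    · have hsw : Ideal.span {a, b} = Ideal.span {b, a} := by rw [Set.pair_comm]
      have h𝔔p : (𝔔.asIdeal : Ideal (blowupAlgebra (Ideal.span {a, b}) b)).IsPrime := 𝔔.isPrime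
      exact @fullCl_loc_blowupAlgebra_congr_over p _ _ _ _ _ hsw b (fun Q hQp hQ => by
        haveI := hQp; exact fullCl_loc_blowupAlgebra_over p b a hb hba hB Q hQ) (𝔔.asIdeal : Ideal (blowupAlgebra (Ideal.span {a, b}) b)) h𝔔p h𝔔
  exact fullCl_of_ringEquiv' p e.symm key

/-- ★ **TRANSPORT FORM** (generators `Φ a₀, Φ b₀` for a ring isomorphism `Φ : B₀ ≃+* 𝒪_{Y,π′y′}`; all hypotheses in `B₀`, FULL only at primes over `𝔪_{B₀}`). [OURS · F6 v2 glue at the stalk] -/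
theorem fullCl_stalk_of_pair_transport_over (p : ℕ) (hπ : IsBlowup π' J) (y' : Y') {B₀ : Type} [CommRing B₀] [IsLocalRing B₀]
    (Φ : B₀ ≃+* Y.presheaf.stalk (π'.base y')) (a₀ b₀ : B₀)
    (hJ : stalkIdeal J (π'.base y') = Ideal.span {Φ a₀, Φ b₀})
    (ha : a₀ ∈ nonZeroDivisors B₀) (hab : ∀ r : B₀, a₀ ∣ r * b₀ → a₀ ∣ r) (hb : b₀ ∈ nonZeroDivisors B₀) (hba : ∀ r : B₀, b₀ ∣ r * a₀ → b₀ ∣ r)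
    (hA : ∀ (Q : Ideal (B₀[X] ⧸ Ideal.span {C a₀ * X - C b₀})) [Q.IsPrime],
      (Q.comap (Ideal.Quotient.mk _)).comap C = maximalIdeal B₀ → FullCl p (Localization.AtPrime Q))
    (hB : ∀ (Q : Ideal (B₀[X] ⧸ Ideal.span {C b₀ * X - C a₀})) [Q.IsPrime],
      (Q.comap (Ideal.Quotient.mk _)).comap C = maximalIdeal B₀ → FullCl p (Localization.AtPrime Q)) :
    FullCl p (Y'.presheaf.stalk y') := by
  obtain ⟨ha', hab'⟩ := regularPair_of_ringEquiv Φ ha hab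
  obtain ⟨hb', hba'⟩ := regularPair_of_ringEquiv Φ hb hba
  obtain ⟨ψ, hψ, -⟩ := exists_pencilQuot_ringEquiv_of_ringEquiv Φ a₀ b₀
  obtain ⟨ψ', hψ', -⟩ := exists_pencilQuot_ringEquiv_of_ringEquiv Φ b₀ a₀
  refine fullCl_stalk_of_pair_stalk_over p hπ y' (Φ a₀) (Φ b₀) hJ ha' hab' hb' hba' (fun Q hQp hQ => ?_) (fun Q hQp hQ => ?_)
  · haveI := hQp
    haveI : (Q.comap ψ.toRingHom).IsPrime := Ideal.comap_isPrime _ Q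
    exact fullCl_localization_of_ringEquiv_at p ψ Q (hA _ (over_of_comap Φ _ _ ψ hψ Q hQ))
  · haveI := hQp
    haveI : (Q.comap ψ'.toRingHom).IsPrime := Ideal.comap_isPrime _ Q
    exact fullCl_localization_of_ringEquiv_at p ψ' Q (hB _ (over_of_comap Φ _ _ ψ' hψ' Q hQ))

/-! ## Over an affine open of the base -/

section Restrict

variable {Xt S' : Scheme.{0}} {τ : S' ⟶ Xt} {𝒥 : Xt.IdealSheafData}

/-- ★★ **FULL STALKS OVER A `γ·(u, v)`-OPEN FROM A REGULAR PAIR OF GERMS, PENCIL RINGS FULL AT THE PRIMES OVER THE POINT.** As ✓ `PencilStalkPackage.fullCl_stalk_of_pair_germ`, with `hW`, `hU`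
required only at the primes of `𝒪_{X̃,x}[X]/(u_x X − v_x)`, `𝒪_{X̃,x}[X]/(v_x X − u_x)` lying over `𝔪_x` (`x = τ s`). [OURS · F6 v2 glue at the stalk; cite: StacksProject, Tag 0804, Tag 0BIQ, Tag 080A] -/
theorem fullCl_stalk_of_pair_germ_over (p : ℕ) (hτ : IsBlowup τ 𝒥) (W : Xt.affineOpens) (γ u v : Γ(Xt, W)) (h𝒥 : 𝒥.ideal W = Ideal.span {γ * u, γ * v})
    (hγ : γ ∈ nonZeroDivisors Γ(Xt, W)) (s : S') (hs : τ.base s ∈ (W : Xt.Opens))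
    (hu : (Xt.presheaf.germ W (τ.base s) hs).hom u ∈ nonZeroDivisors (Xt.presheaf.stalk (τ.base s)))
    (huv : ∀ r : Xt.presheaf.stalk (τ.base s), (Xt.presheaf.germ W (τ.base s) hs).hom u ∣ r * (Xt.presheaf.germ W (τ.base s) hs).hom v →
      (Xt.presheaf.germ W (τ.base s) hs).hom u ∣ r)
    (hv : (Xt.presheaf.germ W (τ.base s) hs).hom v ∈ nonZeroDivisors (Xt.presheaf.stalk (τ.base s)))
    (hvu : ∀ r : Xt.presheaf.stalk (τ.base s), (Xt.presheaf.germ W (τ.base s) hs).hom v ∣ r * (Xt.presheaf.germ W (τ.base s) hs).hom u →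
      (Xt.presheaf.germ W (τ.base s) hs).hom v ∣ r)
    (hW : ∀ (Q : Ideal (Polynomial (Xt.presheaf.stalk (τ.base s)) ⧸ Ideal.span {Polynomial.C ((Xt.presheaf.germ W (τ.base s) hs).hom u) * Polynomial.X -
      Polynomial.C ((Xt.presheaf.germ W (τ.base s) hs).hom v)})) [Q.IsPrime],
      (Q.comap (Ideal.Quotient.mk _)).comap C = maximalIdeal (Xt.presheaf.stalk (τ.base s)) → FullCl p (Localization.AtPrime Q))
    (hU : ∀ (Q : Ideal (Polynomial (Xt.presheaf.stalk (τ.base s)) ⧸ Ideal.span {Polynomial.C ((Xt.presheaf.germ W (τ.base s) hs).hom v) * Polynomial.X -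
      Polynomial.C ((Xt.presheaf.germ W (τ.base s) hs).hom u)})) [Q.IsPrime],
      (Q.comap (Ideal.Quotient.mk _)).comap C = maximalIdeal (Xt.presheaf.stalk (τ.base s)) → FullCl p (Localization.AtPrime Q)) :
    FullCl p (S'.presheaf.stalk s) := by
  haveI : IsAffine (W : Xt.Opens) := W.2
  obtain ⟨e, he⟩ := exists_resTop W
  have hB := isBlowup_restrict_pair hτ W γ u v h𝒥 hγ e he
  obtain ⟨Φ, hΦ⟩ := exists_ringEquiv_stalk_restrict W e he s hs
  have hJ : stalkIdeal (Scheme.IdealSheafData.ofIdealTop (Ideal.span {e u, e v}) : (W : Xt.Opens).toScheme.IdealSheafData) ((τ ∣_ (W : Xt.Opens)).base ⟨s, hs⟩) =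
      Ideal.span {Φ ((Xt.presheaf.germ W (τ.base s) hs).hom u), Φ ((Xt.presheaf.germ W (τ.base s) hs).hom v)} := by
    rw [stalkIdeal_eq_map_germ _ ⟨⊤, isAffineOpen_top _⟩ trivial, ideal_ofIdealTop_top, Ideal.map_span, Set.image_pair, hΦ, hΦ]
  have key : FullCl p ((τ ⁻¹ᵁ (W : Xt.Opens)).toScheme.presheaf.stalk (⟨s, hs⟩ : ↥(τ ⁻¹ᵁ (W : Xt.Opens)))) :=
    fullCl_stalk_of_pair_transport_over p hB ⟨s, hs⟩ Φ _ _ hJ hu huv hv hvu hW hU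
  exact fullCl_of_ringEquiv' p ((τ ⁻¹ᵁ (W : Xt.Opens)).stalkIso ⟨s, hs⟩).commRingCatIsoToRingEquiv key

end Restrict

end Summit.ResolutionOfSingularities.ResolutionOfSingularities.Theorems.FInjectiveMacaulayfication.PencilStalkOverPoint

end
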